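import Summits.QuantumFields.QCD.Theses.PauliWegnerSea

/-!
# `ChiralGluonicCompletion` (crux stmt-QuantumFields-17498) — negative-side support: the corrected (chiral)
# threshold reading of the re-typed `QCDOf`

Definition-free extract of the standing disprover's `Cruxes/ChiralGluonicCompletion/Disproof.lean` §3
(cdisprove gen 1). The crux text allows the completion to "choose z, shift, keep reg, or pass to a subsequence …
but NO LONGER shift the flavour-blind offset". The pre-re-type head `QCDOf N_f ↔ ∃ M₀ ≥ 0, ∃ reg, … ∀ m > M₀ …`
(`GluonicCompletion.Negative.qcdOf_iff_threshold`, whose module no longer elaborates from source since p117723) is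
replaced by the exact statement below: an offset `M₀` may still be absorbed into `m_crit`, but ONLY together with
chirality of the ORIGINAL regularisation above `M₀` (for every rate a tuple with all components `> M₀` and no
uniform lattice gap). The one-directional survivors and the obstruction under a uniform gap above `M₀` are the
landed `RobustYangMillsHandover.Negative.{qcdOf_imp_aboveThreshold, isChiralAtZero_mcrit_shift_iff,
not_isChiralAtZero_mcrit_shift_of_uniformGapAbove}`; this file adds the two-sided characterisation, which is what a
completion of THIS crux may use: the heavy-threshold graft `ThresholdQCD → GluonicCompletion → ChiralGluonicCompletion`
is dead as typed, and an up-shifted witness needs gapless points of the hypothesis' own regularisation above the shift.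
-/

noncomputable section

namespace Summit.QuantumFields.QCD.Theorems.ChiralGluonicCompletion.Negative

open Filter Literature.MathematicalPhysics.QuantumFieldTheory

variable {Nf : ℕ}

/-- **The chiral threshold reading of the re-typed `QCDOf`**: `QCDOf N_f` holds iff, above some common offset
`M₀ ≥ 0`, some mass-scaling regularisation carries the `QCDOf` body at every tuple with all components `> M₀` AND is
chiral above `M₀` (for every rate `ε > 0` some such tuple has no uniform lattice gap `ε`). Proof: shift
`m_crit(k) ↦ m_crit(k) + a_k M₀ / Z_m(k)`, under which the scheme at `m` is the original scheme at `M₀ + m`. [folklore] -/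
theorem qcdOf_iff_chiralThreshold (Nf : ℕ) : QCDOf Nf ↔ ∃ M₀ : ℝ, 0 ≤ M₀ ∧ ∃ reg : QCDRegularisation Nf,
    reg.HasMassScaling ∧
      (∀ ε > (0 : ℝ), ∃ m : Fin Nf → ℝ, (∀ f, M₀ < m f) ∧ ¬ (reg.scheme m 0 0).HasLatticeMassGap ε) ∧
        ∀ m : Fin Nf → ℝ, (∀ f, M₀ < m f) →
          ∃ (z shift : QCDField Nf → ℕ → ℝ) (T : OSData (QCDField Nf) 4),
            IsQCDAlong (reg.scheme m z shift) T ∧ T.IsNontrivial QCDField.glue ∧ T.IsNonGaussian QCDField.glue ∧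
              (∀ f g : Fin Nf, f ≠ g → T.IsNontrivial (QCDField.pseudoRe f g)) ∧
                ∃ Δ > 0, T.HasMassGap Δ ∧ (reg.scheme m z shift).HasLatticeMassGap Δ := by
  constructor
  · rintro ⟨reg, hMS, hch, h⟩
    exact ⟨0, le_rfl, reg, hMS, hch, h⟩
  · rintro ⟨M₀, -, reg, hMS, hch, h⟩
    -- the shifted scheme at `m` is the original scheme at `M₀ + m`
    have hs : ∀ (m : Fin Nf → ℝ) (z shift : QCDField Nf → ℕ → ℝ),
        ({ reg with mcrit := fun k => reg.mcrit k + reg.a k * M₀ / reg.Zm k } : QCDRegularisation Nf).scheme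
          m z shift = reg.scheme (fun f => M₀ + m f) z shift := by
      intro m z shift
      simp only [QCDRegularisation.scheme, QCDScheme.mk.injEq, true_and, and_true]
      funext f k
      ring
    refine ⟨{ reg with mcrit := fun k => reg.mcrit k + reg.a k * M₀ / reg.Zm k }, hMS, fun ε hε => ?_,
      fun m hm => ?_⟩
    · obtain ⟨m, hm, hgap⟩ := hch ε hε
      refine ⟨fun f => m f - M₀, fun f => by linarith [hm f], ?_⟩
      have hm' : (fun f => M₀ + (m f - M₀)) = m := funext fun f => by ring
      rw [hs, hm']
      exact hgap
    · obtain ⟨z, shift, T, hQ, hN, hG, hP, Δ, hΔ, hT, hL⟩ :=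
        h (fun f => M₀ + m f) (fun f => by linarith [hm f])
      refine ⟨z, shift, T, ?_, hN, hG, hP, Δ, hΔ, hT, ?_⟩
      · rwa [hs]
      · rwa [hs]

/-- **Chirality above an offset is monotone in the offset**: gapless points above `M₀' ≥ M₀` are gapless points
above `M₀`. With `M₀ = 0`: a regularisation chiral above ANY non-negative offset is chiral at zero — the pin does not
localise the gapless tuples near `m = 0`. [folklore] -/
theorem chiralAbove_mono (reg : QCDRegularisation Nf) {M₀ M₀' : ℝ} (hle : M₀ ≤ M₀')
    (h : ∀ ε > (0 : ℝ), ∃ m : Fin Nf → ℝ, (∀ f, M₀' < m f) ∧ ¬ (reg.scheme m 0 0).HasLatticeMassGap ε) :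
    ∀ ε > (0 : ℝ), ∃ m : Fin Nf → ℝ, (∀ f, M₀ < m f) ∧ ¬ (reg.scheme m 0 0).HasLatticeMassGap ε := by
  intro ε hε
  obtain ⟨m, hm, hgap⟩ := h ε hε
  exact ⟨m, fun f => lt_of_le_of_lt hle (hm f), hgap⟩

/-- In particular chirality above any `M₀ ≥ 0` already gives the pin `IsChiralAtZero`. [folklore] -/
theorem isChiralAtZero_of_chiralAbove (reg : QCDRegularisation Nf) {M₀ : ℝ} (hM₀ : 0 ≤ M₀)
    (h : ∀ ε > (0 : ℝ), ∃ m : Fin Nf → ℝ, (∀ f, M₀ < m f) ∧ ¬ (reg.scheme m 0 0).HasLatticeMassGap ε) :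
    reg.IsChiralAtZero :=
  chiralAbove_mono reg hM₀ h

end Summit.QuantumFields.QCD.Theorems.ChiralGluonicCompletion.Negative

end
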